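import Literature.NumberTheory.Rogawski1990.ArchStableOrbitalWallStepOrbitMeasure  -- ★ p841391 (R1-e′): the single-family one-step jump + the three readings; brings ★ (R1-a), J1 ★
import Literature.NumberTheory.Automorphic.ArchTorusRegularDense                   -- ★ `Literature.Topology.isOpen_setOf_injective`
import HarnessLib

/-!
# THE ONE-STEP JUMP FOR FINITE LINEAR COMBINATIONS OF STATES ((R1-e″) of R1 «(L-use) at all indefinite places»: the `hstep` shape of ★ p841576's place induction;
# Rogawski 1990 §8.2 p. 122–124, §14.5 p. 238–239)

Topic `NumberTheory/Rogawski1990`; namespace `Literature.NumberTheory.Rogawski1990`.  THEOREMS ONLY (no `def`, no instance, no notation, no axiom, no `sorry`).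
Cell `pub/hodgecm-mathlib`, ENGINE T1 (crux H413 = `stmt-HodgeConjecture-24833`); floor-2 road «(J-nc) in-house», brick (R1-e″) of R1 `stub_LuseAllPlaces` (LEAD F0P3a-plan (g9)
WORD T8-77; census `CENSUS-R1e-LuseAssembly` 31a194b6; author F0P3a-p07 (g7), 2026-09-01).

WHAT.  ★ p841391 `exists_tendsto_deriv_sin_mul_sum_integral_pi_update_splitCurve` is the jump for ONE family of measures `μ` at the places `≠ w`; the abstract place induction ★ p841576
`PlaceInduction.sum_prod_mul_eq_of_step_of_regular_eq` consumes it for FINITE LINEAR COMBINATIONS `Σ_i s_i · Σ_ρ I(μ_i[w ↦ …])` (the states after earlier places carry a sum over the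
relabellings already chosen), with the right-hand side in the product form `κ_w(ρ) · I(μ_i[w ↦ Wm_w(ρ)])`, `κ_w(ρ) = (cw ? 2 : c_{ρ⁻¹})`, `Wm_w(ρ) = (cw ? ν.map conj_{diag(z₀∘ρ)} : μ^{sing}_ρ)`.
THIS FILE: §1 `differentiableAt_sum_integral_pi_update_map_conj_splitCurve` — the single-family function `ψ ↦ Σ_ρ I(μ[w ↦ reg(γ_{z₀}(ψ)∘ρ)])` is differentiable at every `ψ` where the
curve is regular (★ (R1-a) test function + ★ p841391 §2 reading on the OPEN regular set ★ `isOpen_setOf_injective` + J1 §1 ★ `differentiableAt_integral_comp_conj_splitCurve_comp_perm`);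
§2 **`exists_tendsto_deriv_sin_mul_sum_sum_integral_pi_update_splitCurve`** — the multi-family jump in exactly ★ p841576's `hstep` shape (`deriv` of a finite linear combination = combination of `deriv`s on
the regular window; `tendsto_finsetSum`; the `ite` reshaping).
HONEST LABEL: HC_CM is proved only modulo the 7 printed citations until rung 0 closes; this file is calculus bookkeeping over ★ p841391 and pays nothing by itself.

## References
* [Rogawski1990] J. D. Rogawski, *Automorphic Representations of Unitary Groups in Three Variables*, Ann. of Math. Stud. 123 (1990), §8.2 p. 122–124, §14.5 p. 238–239.
* [Varadarajan1989] V. S. Varadarajan, *An Introduction to Harmonic Analysis on Semisimple Lie Groups* (1989), §6.4 Thm 22.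
-/

set_option autoImplicit false

noncomputable section

open MeasureTheory Measure Filter Topology NumberField NumberField.InfinitePlace NumberField.mixedEmbedding Equiv Function Set
open Literature.MeasureTheory.Group Literature.NumberTheory.Automorphic Literature.NumberTheory.Automorphic.UnitaryGroup
open Literature.LinearAlgebra.Matrix
open scoped Matrix MatrixGroups Matrix.Norms.Operator ContDiff

namespace Literature.NumberTheory.Rogawski1990

variable (L : Type) [Field L] [NumberField L] [IsCMField L] (α : Fin 3 → L) (w : {w : InfinitePlace L // IsComplex w})
  [MeasurableSpace (GL (Fin 3) ℂ)] [BorelSpace (GL (Fin 3) ℂ)]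
  [MeasurableSpace (arch (↥(maximalRealSubfield L)) L (IsCMField.complexConj L) 3 (Matrix.diagonal α))] [BorelSpace (arch (↥(maximalRealSubfield L)) L (IsCMField.complexConj L) 3 (Matrix.diagonal α))]

/-! ## §1 Differentiability of the single-family state on the regular window -/

open scoped Classical in
/-- **The single-family state `ψ ↦ Σ_ρ I(μ[w ↦ ν.map conj_{diag(γ_{z₀}(ψ)∘ρ)}])` is differentiable at every `ψ` where `γ_{z₀}(ψ)` is regular**: on the OPEN regular set it is
`Σ_ρ ∫ Θ′ ↑↑(y·diag(γ(ψ)∘ρ)·y⁻¹) dν` (★ (R1-a), ★ p841391 §2), termwise differentiable by J1 §1 ★. [cite: Rogawski1990, §8.2 p. 122–123] -/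
theorem differentiableAt_sum_integral_pi_update_map_conj_splitCurve
    (hα : ∀ i, α i ≠ 0) (hherm : ∀ i, (IsCMField.complexConj L (α i) : L) = α i)
    (ν : Measure (archLocal L 3 (Matrix.diagonal α) w)) [IsFiniteMeasureOnCompacts ν]
    (Θ : Matrix (Fin 3) (Fin 3) (mixedSpace L) → ℂ) (hΘ : ContDiff ℝ (⊤ : ℕ∞) Θ)
    (hΘc : HasCompactSupport fun g : arch (↥(maximalRealSubfield L)) L (IsCMField.complexConj L) 3 (Matrix.diagonal α) => Θ ((g : GL (Fin 3) (mixedSpace L)) : Matrix (Fin 3) (Fin 3) (mixedSpace L)))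
    (μall : ∀ v : {w : InfinitePlace L // IsComplex w}, Measure (archLocal L 3 (Matrix.diagonal α) v)) [∀ v, IsFiniteMeasureOnCompacts (μall v)] [∀ v, SigmaFinite (μall v)]
    (z₀ : Fin 3 → Circle) {ψ : ℝ} (hψ : Function.Injective (fun i => z₀ i * Circle.exp (![(1 : ℝ), 0, -1] i * ψ))) :
    DifferentiableAt ℝ (fun ψ : ℝ => ∑ ρ : Perm (Fin 3),
      ∫ o, Θ ((((archPiEquivCM 3 L (Matrix.diagonal α)).symm o : arch (↥(maximalRealSubfield L)) L (IsCMField.complexConj L) 3 (Matrix.diagonal α)) : GL (Fin 3) (mixedSpace L)) : Matrix (Fin 3) (Fin 3) (mixedSpace L))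
                ∂(Measure.pi (Function.update μall w (ν.map fun y : archLocal L 3 (Matrix.diagonal α) w => y * (⟨circleDiagonal 3 ((fun i => z₀ i * Circle.exp (![(1 : ℝ), 0, -1] i * ψ)) ∘ ⇑ρ), circleDiagonal_mem_archLocal_diagonal L 3 α w ((fun i => z₀ i * Circle.exp (![(1 : ℝ), 0, -1] i * ψ)) ∘ ⇑ρ)⟩ : archLocal L 3 (Matrix.diagonal α) w) * y⁻¹)))) ψ := by
  haveI : ∀ v : {w : InfinitePlace L // IsComplex w}, LocallyCompactSpace (archLocal L 3 (Matrix.diagonal α) v) := fun v => locallyCompactSpace_archLocal L 3 (Matrix.diagonal α) v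
  haveI : ∀ v : {w : InfinitePlace L // IsComplex w}, SecondCountableTopology (archLocal L 3 (Matrix.diagonal α) v) := fun v => secondCountableTopology_archLocal L 3 (Matrix.diagonal α) v
  have hreal : ∀ i, (w.1.embedding (α i)).im = 0 := fun i => im_embedding_eq_zero_of_complexConj_eq L w (hherm i)
  obtain ⟨Θ', hΘ'd, hΘ'c, hΘ'eq⟩ := exists_contDiff_eq_integral_insert L 3 α hα w (fun w' : {v : {w : InfinitePlace L // IsComplex w} // ¬ v = w} => μall w'.1) Θ hΘ hΘc
  -- the regular set of the curve is open and contains `ψ`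
  have hopen : IsOpen {ψ' : ℝ | Function.Injective (fun i => z₀ i * Circle.exp (![(1 : ℝ), 0, -1] i * ψ'))} :=
    (Literature.Topology.isOpen_setOf_injective (X := Circle)).preimage (continuous_torusCurve z₀ ![(1 : ℝ), 0, -1])
  -- on it, the state is J1's function at `Θ'`
  have hev : (fun ψ : ℝ => ∑ ρ : Perm (Fin 3),
      ∫ o, Θ ((((archPiEquivCM 3 L (Matrix.diagonal α)).symm o : arch (↥(maximalRealSubfield L)) L (IsCMField.complexConj L) 3 (Matrix.diagonal α)) : GL (Fin 3) (mixedSpace L)) : Matrix (Fin 3) (Fin 3) (mixedSpace L))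
                ∂(Measure.pi (Function.update μall w (ν.map fun y : archLocal L 3 (Matrix.diagonal α) w => y * (⟨circleDiagonal 3 ((fun i => z₀ i * Circle.exp (![(1 : ℝ), 0, -1] i * ψ)) ∘ ⇑ρ), circleDiagonal_mem_archLocal_diagonal L 3 α w ((fun i => z₀ i * Circle.exp (![(1 : ℝ), 0, -1] i * ψ)) ∘ ⇑ρ)⟩ : archLocal L 3 (Matrix.diagonal α) w) * y⁻¹)))) =ᶠ[𝓝 ψ]
      fun ψ : ℝ => ∑ ρ : Perm (Fin 3), ∫ g : archLocal L 3 (Matrix.diagonal α) w,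
        Θ' ((((g * ⟨circleDiagonal 3 ((fun i => z₀ i * Circle.exp (![(1 : ℝ), 0, -1] i * ψ)) ∘ ⇑ρ), circleDiagonal_mem_archLocal_diagonal L 3 α w _⟩ * g⁻¹ :
          archLocal L 3 (Matrix.diagonal α) w) : GL (Fin 3) ℂ) : Matrix (Fin 3) (Fin 3) ℂ)) ∂ν := by
    filter_upwards [hopen.mem_nhds hψ] with ψ' hψ'
    exact Finset.sum_congr rfl fun ρ _ => integral_pi_update_map_conj_eq_integral L α w μall ν _
      (fun C hC => isCompact_setOf_conj_circleDiagonal_mem_of_injective L 3 α w hα _ (hψ'.comp ρ.injective) C hC) Θ hΘ.continuous hΘc Θ' hΘ'd.continuous hΘ'eq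
  refine DifferentiableAt.congr_of_eventuallyEq ?_ hev
  exact DifferentiableAt.fun_sum fun ρ _ =>
    differentiableAt_integral_comp_conj_splitCurve_comp_perm L α w hα hreal ν Θ' (hΘ'd.of_le (by exact_mod_cast le_top)) hΘ'c z₀ ρ hψ

/-! ## §2 The multi-family jump -/

open scoped Classical in
/-- **(R1-e″) THE ONE-STEP JUMP FOR FINITE LINEAR COMBINATIONS OF STATES** — ★ p841391 summed over finitely many families `μ_i` with scalars `s_i`, right-hand side in the product
form `κ_w(ρ)·I(μ_i[w ↦ Wm_w(ρ)])`: exactly the `hstep` of ★ p841576 `PlaceInduction.sum_prod_mul_eq_of_step_of_regular_eq`. [cite: Rogawski1990, §8.2 p. 124; §14.5 p. 238]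
[cite: Varadarajan1989, §6.4 Thm 22] -/
theorem exists_tendsto_deriv_sin_mul_sum_sum_integral_pi_update_splitCurve
    (hα : ∀ i, α i ≠ 0) (hherm : ∀ i, (IsCMField.complexConj L (α i) : L) = α i)
    (ν : Measure (archLocal L 3 (Matrix.diagonal α) w)) [ν.IsHaarMeasure] [ν.IsMulRightInvariant]
    (z₁ : Fin 3 → Circle) (h02 : z₁ 0 = z₁ 2) (h01 : z₁ 0 ≠ z₁ 1)
    [∀ τ : Perm (Fin 3), MeasurableSpace (archLocal L 3 (Matrix.diagonal (α ∘ ⇑τ)) w ⧸ Subgroup.centralizer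
      ({(⟨circleDiagonal 3 z₁, circleDiagonal_mem_archLocal_diagonal L 3 (α ∘ ⇑τ) w z₁⟩ : archLocal L 3 (Matrix.diagonal (α ∘ ⇑τ)) w)} :
        Set (archLocal L 3 (Matrix.diagonal (α ∘ ⇑τ)) w)))]
    [∀ τ : Perm (Fin 3), BorelSpace (archLocal L 3 (Matrix.diagonal (α ∘ ⇑τ)) w ⧸ Subgroup.centralizer
      ({(⟨circleDiagonal 3 z₁, circleDiagonal_mem_archLocal_diagonal L 3 (α ∘ ⇑τ) w z₁⟩ : archLocal L 3 (Matrix.diagonal (α ∘ ⇑τ)) w)} :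
        Set (archLocal L 3 (Matrix.diagonal (α ∘ ⇑τ)) w)))]
    (νH : ∀ τ : Perm (Fin 3), Measure (Subgroup.centralizer
      ({(⟨circleDiagonal 3 z₁, circleDiagonal_mem_archLocal_diagonal L 3 (α ∘ ⇑τ) w z₁⟩ : archLocal L 3 (Matrix.diagonal (α ∘ ⇑τ)) w)} :
        Set (archLocal L 3 (Matrix.diagonal (α ∘ ⇑τ)) w))))
    [∀ τ, (νH τ).IsHaarMeasure] [∀ τ, (νH τ).IsInvInvariant] :
    haveI : ∀ τ : Perm (Fin 3), LocallyCompactSpace (archLocal L 3 (Matrix.diagonal (α ∘ ⇑τ)) w) := fun τ => locallyCompactSpace_archLocal L 3 (Matrix.diagonal (α ∘ ⇑τ)) w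
    haveI : ∀ τ : Perm (Fin 3), SecondCountableTopology (archLocal L 3 (Matrix.diagonal (α ∘ ⇑τ)) w) := fun τ => secondCountableTopology_archLocal L 3 (Matrix.diagonal (α ∘ ⇑τ)) w
    haveI : ∀ τ : Perm (Fin 3), (ν.map (ContinuousMulEquiv.restrictSubgroup (GLn.conjEquiv (Matrix.GeneralLinearGroup.mkOfDetNeZero _ (det_monomial_one_ne_zero 3 τ)))
            (archLocal L 3 (Matrix.diagonal (α ∘ ⇑τ)) w) (archLocal L 3 (Matrix.diagonal α) w)
            (mem_archLocal_comp_perm_iff_conj_mem L 3 α w τ)).symm).IsMulRightInvariant := fun τ => isMulRightInvariant_map_relabel_symm L 3 α w τ ν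
    haveI : ∀ τ : Perm (Fin 3), (ν.map (ContinuousMulEquiv.restrictSubgroup (GLn.conjEquiv (Matrix.GeneralLinearGroup.mkOfDetNeZero _ (det_monomial_one_ne_zero 3 τ)))
            (archLocal L 3 (Matrix.diagonal (α ∘ ⇑τ)) w) (archLocal L 3 (Matrix.diagonal α) w)
            (mem_archLocal_comp_perm_iff_conj_mem L 3 α w τ)).symm).IsHaarMeasure := fun _ => ContinuousMulEquiv.isHaarMeasure_map ν _
    ∃ c : Perm (Fin 3) → ℂ,
      (∀ τ : Perm (Fin 3), (w.1.embedding (α (τ 0))).re * (w.1.embedding (α (τ 2))).re < 0 → c τ ≠ 0) ∧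
      ∀ (Θ : Matrix (Fin 3) (Fin 3) (mixedSpace L) → ℂ), ContDiff ℝ (⊤ : ℕ∞) Θ →
        HasCompactSupport (fun g : arch (↥(maximalRealSubfield L)) L (IsCMField.complexConj L) 3 (Matrix.diagonal α) => Θ ((g : GL (Fin 3) (mixedSpace L)) : Matrix (Fin 3) (Fin 3) (mixedSpace L))) →
        ∀ (ι : Type) [Fintype ι] (s : ι → ℂ) (μfam : ι → ∀ v : {w : InfinitePlace L // IsComplex w}, Measure (archLocal L 3 (Matrix.diagonal α) v)),
        (∀ i v, IsFiniteMeasureOnCompacts (μfam i v) ∧ SigmaFinite (μfam i v)) →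
        ∀ (z₀ : Fin 3 → Circle) (h02' : z₀ 0 = z₀ 2) (h01' : z₀ 0 ≠ z₀ 1),
          Tendsto (fun ψ : ℝ => deriv (fun ψ : ℝ => (2 * Real.sin ψ : ℂ) * ∑ i, s i * ∑ ρ : Perm (Fin 3),
              ∫ o, Θ ((((archPiEquivCM 3 L (Matrix.diagonal α)).symm o : arch (↥(maximalRealSubfield L)) L (IsCMField.complexConj L) 3 (Matrix.diagonal α)) : GL (Fin 3) (mixedSpace L)) : Matrix (Fin 3) (Fin 3) (mixedSpace L))
                ∂(Measure.pi (Function.update (μfam i) w (ν.map fun y : archLocal L 3 (Matrix.diagonal α) w => y * (⟨circleDiagonal 3 ((fun i => z₀ i * Circle.exp (![(1 : ℝ), 0, -1] i * ψ)) ∘ ⇑ρ), circleDiagonal_mem_archLocal_diagonal L 3 α w ((fun i => z₀ i * Circle.exp (![(1 : ℝ), 0, -1] i * ψ)) ∘ ⇑ρ)⟩ : archLocal L 3 (Matrix.diagonal α) w) * y⁻¹)))) ψ)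
            (𝓝[>] 0)
            (𝓝 (∑ i, s i * ∑ ρ : Perm (Fin 3),
              (if 0 < (w.1.embedding (α (ρ⁻¹ 0))).re * (w.1.embedding (α (ρ⁻¹ 2))).re then (2 : ℂ) else c ρ⁻¹) *
                ∫ o, Θ ((((archPiEquivCM 3 L (Matrix.diagonal α)).symm o : arch (↥(maximalRealSubfield L)) L (IsCMField.complexConj L) 3 (Matrix.diagonal α)) : GL (Fin 3) (mixedSpace L)) : Matrix (Fin 3) (Fin 3) (mixedSpace L))
                ∂(Measure.pi (Function.update (μfam i) w (if 0 < (w.1.embedding (α (ρ⁻¹ 0))).re * (w.1.embedding (α (ρ⁻¹ 2))).re then ν.map fun y : archLocal L 3 (Matrix.diagonal α) w => y * (⟨circleDiagonal 3 (z₀ ∘ ⇑ρ), circleDiagonal_mem_archLocal_diagonal L 3 α w (z₀ ∘ ⇑ρ)⟩ : archLocal L 3 (Matrix.diagonal α) w) * y⁻¹ else ((quotientMeasure _ (νH ρ⁻¹) (isClosed_coe_centralizer_singleton _) (ν.map (ContinuousMulEquiv.restrictSubgroup (GLn.conjEquiv (Matrix.GeneralLinearGroup.mkOfDetNeZero _ (det_monomial_one_ne_zero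 3 ρ⁻¹)))
            (archLocal L 3 (Matrix.diagonal (α ∘ ⇑ρ⁻¹)) w) (archLocal L 3 (Matrix.diagonal α) w)
            (mem_archLocal_comp_perm_iff_conj_mem L 3 α w ρ⁻¹)).symm)).map
                  (descConj (⟨circleDiagonal 3 z₀, circleDiagonal_mem_archLocal_diagonal L 3 (α ∘ ⇑ρ⁻¹) w z₀⟩ : archLocal L 3 (Matrix.diagonal (α ∘ ⇑ρ⁻¹)) w)
                    (Subgroup.centralizer ({(⟨circleDiagonal 3 z₁, circleDiagonal_mem_archLocal_diagonal L 3 (α ∘ ⇑ρ⁻¹) w z₁⟩ :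
                      archLocal L 3 (Matrix.diagonal (α ∘ ⇑ρ⁻¹)) w)} : Set (archLocal L 3 (Matrix.diagonal (α ∘ ⇑ρ⁻¹)) w)))
                    (forall_mem_centralizer_circleDiagonal_comm_of_wall L (α ∘ ⇑ρ⁻¹) w h02 h01 h02' h01') id)).map
                  (ContinuousMulEquiv.restrictSubgroup (GLn.conjEquiv (Matrix.GeneralLinearGroup.mkOfDetNeZero _ (det_monomial_one_ne_zero 3 ρ⁻¹)))
            (archLocal L 3 (Matrix.diagonal (α ∘ ⇑ρ⁻¹)) w) (archLocal L 3 (Matrix.diagonal α) w)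
            (mem_archLocal_comp_perm_iff_conj_mem L 3 α w ρ⁻¹))))))) := by
  classical
  haveI hLC : ∀ τ : Perm (Fin 3), LocallyCompactSpace (archLocal L 3 (Matrix.diagonal (α ∘ ⇑τ)) w) :=
    fun τ => locallyCompactSpace_archLocal L 3 (Matrix.diagonal (α ∘ ⇑τ)) w
  haveI hSC : ∀ τ : Perm (Fin 3), SecondCountableTopology (archLocal L 3 (Matrix.diagonal (α ∘ ⇑τ)) w) :=
    fun τ => secondCountableTopology_archLocal L 3 (Matrix.diagonal (α ∘ ⇑τ)) w
  haveI hLCv : ∀ v : {w : InfinitePlace L // IsComplex w}, LocallyCompactSpace (archLocal L 3 (Matrix.diagonal α) v) := fun v => locallyCompactSpace_archLocal L 3 (Matrix.diagonal α) v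
  haveI hSCv : ∀ v : {w : InfinitePlace L // IsComplex w}, SecondCountableTopology (archLocal L 3 (Matrix.diagonal α) v) := fun v => secondCountableTopology_archLocal L 3 (Matrix.diagonal α) v
  obtain ⟨c, hc, hJ⟩ := exists_tendsto_deriv_sin_mul_sum_integral_pi_update_splitCurve L α w hα hherm ν z₁ h02 h01 νH
  refine ⟨c, hc, fun Θ hΘ hΘc ι _ s μfam hμ z₀ h02' h01' => ?_⟩
  haveI : ∀ i v, IsFiniteMeasureOnCompacts (μfam i v) := fun i v => (hμ i v).1
  haveI : ∀ i v, SigmaFinite (μfam i v) := fun i v => (hμ i v).2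
  -- the single-family jumps
  have hJi := fun i => hJ Θ hΘ hΘc (μfam i) z₀ h02' h01'
  -- the regularity window
  have hev : ∀ᶠ ψ in 𝓝[>] (0 : ℝ), Function.Injective (fun i => z₀ i * Circle.exp (![(1 : ℝ), 0, -1] i * ψ)) :=
    (eventually_injective_splitCurve z₀ h02' h01').filter_mono (nhdsWithin_mono _ fun x (hx : 0 < x) => ne_of_gt hx)
  -- on the window, the derivative of the combination is the combination of the derivatives
  have hderiv : ∀ᶠ ψ in 𝓝[>] (0 : ℝ),
      deriv (fun ψ : ℝ => (2 * Real.sin ψ : ℂ) * ∑ i, s i * ∑ ρ : Perm (Fin 3),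
        ∫ o, Θ ((((archPiEquivCM 3 L (Matrix.diagonal α)).symm o : arch (↥(maximalRealSubfield L)) L (IsCMField.complexConj L) 3 (Matrix.diagonal α)) : GL (Fin 3) (mixedSpace L)) : Matrix (Fin 3) (Fin 3) (mixedSpace L))
                ∂(Measure.pi (Function.update (μfam i) w (ν.map fun y : archLocal L 3 (Matrix.diagonal α) w => y * (⟨circleDiagonal 3 ((fun i => z₀ i * Circle.exp (![(1 : ℝ), 0, -1] i * ψ)) ∘ ⇑ρ), circleDiagonal_mem_archLocal_diagonal L 3 α w ((fun i => z₀ i * Circle.exp (![(1 : ℝ), 0, -1] i * ψ)) ∘ ⇑ρ)⟩ : archLocal L 3 (Matrix.diagonal α) w) * y⁻¹)))) ψ =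
      ∑ i, s i * deriv (fun ψ : ℝ => (2 * Real.sin ψ : ℂ) * ∑ ρ : Perm (Fin 3),
        ∫ o, Θ ((((archPiEquivCM 3 L (Matrix.diagonal α)).symm o : arch (↥(maximalRealSubfield L)) L (IsCMField.complexConj L) 3 (Matrix.diagonal α)) : GL (Fin 3) (mixedSpace L)) : Matrix (Fin 3) (Fin 3) (mixedSpace L))
                ∂(Measure.pi (Function.update (μfam i) w (ν.map fun y : archLocal L 3 (Matrix.diagonal α) w => y * (⟨circleDiagonal 3 ((fun i => z₀ i * Circle.exp (![(1 : ℝ), 0, -1] i * ψ)) ∘ ⇑ρ), circleDiagonal_mem_archLocal_diagonal L 3 α w ((fun i => z₀ i * Circle.exp (![(1 : ℝ), 0, -1] i * ψ)) ∘ ⇑ρ)⟩ : archLocal L 3 (Matrix.diagonal α) w) * y⁻¹)))) ψ := by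
    filter_upwards [hev] with ψ hψ
    have hsin : DifferentiableAt ℝ (fun ψ : ℝ => (2 * Real.sin ψ : ℂ)) ψ :=
      (((Real.hasDerivAt_sin ψ).ofReal_comp).const_mul (2 : ℂ)).differentiableAt
    have hF : ∀ i, DifferentiableAt ℝ (fun ψ : ℝ => (2 * Real.sin ψ : ℂ) * ∑ ρ : Perm (Fin 3),
        ∫ o, Θ ((((archPiEquivCM 3 L (Matrix.diagonal α)).symm o : arch (↥(maximalRealSubfield L)) L (IsCMField.complexConj L) 3 (Matrix.diagonal α)) : GL (Fin 3) (mixedSpace L)) : Matrix (Fin 3) (Fin 3) (mixedSpace L))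
                ∂(Measure.pi (Function.update (μfam i) w (ν.map fun y : archLocal L 3 (Matrix.diagonal α) w => y * (⟨circleDiagonal 3 ((fun i => z₀ i * Circle.exp (![(1 : ℝ), 0, -1] i * ψ)) ∘ ⇑ρ), circleDiagonal_mem_archLocal_diagonal L 3 α w ((fun i => z₀ i * Circle.exp (![(1 : ℝ), 0, -1] i * ψ)) ∘ ⇑ρ)⟩ : archLocal L 3 (Matrix.diagonal α) w) * y⁻¹)))) ψ := fun i =>
      hsin.mul (differentiableAt_sum_integral_pi_update_map_conj_splitCurve L α w hα hherm ν Θ hΘ hΘc (μfam i) z₀ hψ)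
    have hfun : (fun ψ : ℝ => (2 * Real.sin ψ : ℂ) * ∑ i, s i * ∑ ρ : Perm (Fin 3),
        ∫ o, Θ ((((archPiEquivCM 3 L (Matrix.diagonal α)).symm o : arch (↥(maximalRealSubfield L)) L (IsCMField.complexConj L) 3 (Matrix.diagonal α)) : GL (Fin 3) (mixedSpace L)) : Matrix (Fin 3) (Fin 3) (mixedSpace L))
                ∂(Measure.pi (Function.update (μfam i) w (ν.map fun y : archLocal L 3 (Matrix.diagonal α) w => y * (⟨circleDiagonal 3 ((fun i => z₀ i * Circle.exp (![(1 : ℝ), 0, -1] i * ψ)) ∘ ⇑ρ), circleDiagonal_mem_archLocal_diagonal L 3 α w ((fun i => z₀ i * Circle.exp (![(1 : ℝ), 0, -1] i * ψ)) ∘ ⇑ρ)⟩ : archLocal L 3 (Matrix.diagonal α) w) * y⁻¹)))) =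
        ∑ i, fun ψ : ℝ => s i * ((2 * Real.sin ψ : ℂ) * ∑ ρ : Perm (Fin 3),
          ∫ o, Θ ((((archPiEquivCM 3 L (Matrix.diagonal α)).symm o : arch (↥(maximalRealSubfield L)) L (IsCMField.complexConj L) 3 (Matrix.diagonal α)) : GL (Fin 3) (mixedSpace L)) : Matrix (Fin 3) (Fin 3) (mixedSpace L))
                ∂(Measure.pi (Function.update (μfam i) w (ν.map fun y : archLocal L 3 (Matrix.diagonal α) w => y * (⟨circleDiagonal 3 ((fun i => z₀ i * Circle.exp (![(1 : ℝ), 0, -1] i * ψ)) ∘ ⇑ρ), circleDiagonal_mem_archLocal_diagonal L 3 α w ((fun i => z₀ i * Circle.exp (![(1 : ℝ), 0, -1] i * ψ)) ∘ ⇑ρ)⟩ : archLocal L 3 (Matrix.diagonal α) w) * y⁻¹)))) := by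
      funext ψ
      rw [Finset.sum_apply, Finset.mul_sum]
      exact Finset.sum_congr rfl fun i _ => by ring
    rw [hfun, deriv_sum fun i _ => (hF i).const_mul (s i)]
    exact Finset.sum_congr rfl fun i _ => deriv_const_mul (s i) (hF i)
  -- sum the single-family limits and reshape the right-hand side
  have hsum := tendsto_finsetSum (Finset.univ : Finset ι) fun i _ => (hJi i).const_mul (s i)
  have h2 := hsum.congr' (hderiv.mono fun ψ h => h.symm)
  convert h2 using 2
  refine Finset.sum_congr rfl fun i _ => ?_
  congr 1
  refine Finset.sum_congr rfl fun ρ _ => ?_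
  split_ifs <;> rfl

end Literature.NumberTheory.Rogawski1990

end
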